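import Literature.Probability.Percolation.KozmaNitzanLemma3iCluster
import Literature.Probability.Percolation.PercolationProofs
import HarnessLib

/-!
# `NoHeavyLowerTail` (stmt-CriticalPhenomena-4575), |A| = 5 rung, glued half — the weakest target ALONE versus the blob of the others

Support file (prover prim-cplus-engine gen 11; `--supports stmt-CriticalPhenomena-4575`).  No definition, no named
fact, no sorry.

Setting: `μ = prodBernoulli w` on a finite vertex type, an observer `o`, a target `a` and a finite set `R` of further
targets containing a distinguished `i ∈ R` with `μ(o ↔ a) ≤ μ(o ↔ i)` (e.g. `a` = the target least connected to `o`,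
the `argmin` of the glued half of the `|A| = 5` one-cut rung, `R` = the other targets).  Then

  `μ( o ↔ a,  o ↮ i,  i ↔ j ∀ j ∈ R )  ≤  μ( o ↮ a,  o ↔ j ∀ j ∈ R )`                     (`weakestAlone_blob_le`)

i.e. "`o` reaches its weakest target `a` but not the blob `R` (while `R` is one blob) no more often than `o` reaches the
whole of `R` but not `a`".  With `R = {a₁,a₂,a₃}` this is the inequality `C6a` of the |A| = 5 assembly
(prim-a5/ASSEMBLY.md §8: `P(B = {a_k}) ≤ P(B = A′∖a_k)`, `k = argmin μ(o↔a_i)`) RESTRICTED TO THE EVENT that the three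
other targets are mutually connected — the part of `C6a`/`X′(5)@o` that is TIGHT on the census equality family
('1+3 ties': three targets glued, `μ(o↔a_k) = μ(o↔blob)`); the complementary part (the three others not all connected)
is NOT bounded by the same right-hand side in general (exact tree counterexample in the seat memo ENGINE-g11 §3), so this
file is a partial result, not `C6a`.

Proof = Kozma–Nitzan 2024 Lemma 3(i) (tree: `KozmaNitzan2024_lemma3_i_cluster`, joint form, from BHK 2006 Thms 1.3/1.4)
for the monotone cluster property `o ∈ C(·)`, the pair `(a, i)` and the increasing event `Q = {i ↔ j ∀ j ∈ R}` read on
the edge cluster of `i`:  `μ({o↔a} ∩ Q) ≤ μ({o↔i} ∩ Q)`; removing the common part `{o↔a} ∩ {o↔i} ∩ Q` from both sides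
and using `{o↔i} ∩ Q ⊆ ⋂_{j∈R} {o↔j}` (transitivity) gives the claim.
[cite: KozmaNitzan2024, Lemma 3(i) (pp. 6–7); VandenbergHaggstromKahn2005, Thms 1.3–1.4]
-/

noncomputable section

namespace Summit.CriticalPhenomena.PercolationContinuityZ3.Theorems

open MeasureTheory Set Literature.Probability.Percolation
open Literature.Probability.LatticeModels (prodBernoulli)

namespace WeakestAloneBlob

variable {V : Type*} [Fintype V]

omit [Fintype V] in
/-- The blob event `Q = ⋂_{j ∈ R} {i ↔ j}` is read on the edge cluster of `i`: it is `{C_i ∈ 𝒬}` for the upper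
family `𝒬 = ⋂_{j ∈ R} connFamily i j`. [cite: VandenbergHaggstromKahn2005, §1 p. 3] -/
theorem biInter_openConn_eq_setOf (i : V) (R : Finset V) :
    (⋂ j ∈ R, (openConn i j : Set (BondConfig V))) =
      {ω | openEdgeCluster ω i ∈ ⋂ j ∈ R, KNPreFKG.connFamily i j} := by
  ext ω
  simp only [mem_iInter, mem_setOf_eq]
  refine forall₂_congr fun j _ => ?_
  have h := KNPreFKG.openConn_eq_setOf_connFamily (V := V) i j
  have := congrArg (fun S : Set (BondConfig V) => ω ∈ S) h
  simpa using this

omit [Fintype V] in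
/-- `⋂_{j ∈ R} connFamily i j` is an upper family of edge sets. [folklore] -/
theorem isUpperSet_biInter_connFamily (i : V) (R : Finset V) :
    IsUpperSet (⋂ j ∈ R, KNPreFKG.connFamily (V := V) i j) := by
  intro C C' hCC' hC
  simp only [mem_iInter] at hC ⊢
  exact fun j hj => KNPreFKG.isUpperSet_connFamily i j hCC' (hC j hj)

omit [Fintype V] in
/-- `{ω | o ∈ C(x)} = {x ↔ o} = {o ↔ x}`. [folklore] -/
theorem setOf_mem_openCluster_eq (o x : V) :
    {ω : BondConfig V | o ∈ openCluster ω x} = openConn o x := by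
  ext ω
  simp only [mem_setOf_eq, openCluster, openConn]
  exact ⟨fun h => h.symm, fun h => h.symm⟩

/-- Measurability of `{x ↔ y}` on a finite vertex type. [folklore] -/
theorem measurableSet_openConn' (x y : V) : MeasurableSet (openConn x y : Set (BondConfig V)) :=
  measurableSet_openConn_holds x y

end WeakestAloneBlob

open WeakestAloneBlob in
/-- **The weakest target alone versus the blob of the others.**  For `μ = prodBernoulli w` on a finite vertex type,
an observer `o`, targets `a`, `i` and a finite target set `R` (typically `i ∈ R`) with `μ(o ↔ a) ≤ μ(o ↔ i)`:
`μ({o ↔ a} ∩ {o ↮ i} ∩ ⋂_{j∈R} {i ↔ j}) ≤ μ({o ↮ a} ∩ ⋂_{j∈R} {o ↔ j})`.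
For the glued half of the |A| = 5 one-cut rung (`o` the observer-relay, `a` = argmin_x μ(o ↔ x), `R` the three
other targets) this is `P(B = {a}, R mutually connected) ≤ P(B = R)`, the blob-event part of `C6a`.
[cite: KozmaNitzan2024, Lemma 3(i) (pp. 6–7)] -/
theorem weakestAlone_blob_le {V : Type*} [Fintype V] (w : Sym2 V → unitInterval) (o a i : V) (R : Finset V)
    (h : (prodBernoulli w).real (openConn o a) ≤ (prodBernoulli w).real (openConn o i)) :
    (prodBernoulli w).real
        ((openConn o a : Set (BondConfig V)) ∩ (openConn o i)ᶜ ∩ ⋂ j ∈ R, openConn i j) ≤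
      (prodBernoulli w).real ((openConn o a : Set (BondConfig V))ᶜ ∩ ⋂ j ∈ R, openConn o j) := by
  classical
  set μ := prodBernoulli w with hμ
  set Q : Set (BondConfig V) := ⋂ j ∈ R, (openConn i j : Set (BondConfig V)) with hQ
  set Xa : Set (BondConfig V) := openConn o a with hXa
  set Xi : Set (BondConfig V) := openConn o i with hXi
  -- Lemma 3(i) of Kozma–Nitzan for the monotone cluster property `o ∈ C(·)` and the increasing event `Q` in `C_i`
  have hP : ∀ S T : Set V, S ⊆ T → o ∈ S → o ∈ T := fun S T hST hS => hST hS
  have hup := isUpperSet_biInter_connFamily (V := V) i R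
  have h' : μ.real {ω : BondConfig V | o ∈ openCluster ω a} ≤
      μ.real {ω : BondConfig V | o ∈ openCluster ω i} + 0 := by
    rw [setOf_mem_openCluster_eq, setOf_mem_openCluster_eq, add_zero]; exact h
  have key := KozmaNitzan2024_lemma3_i_cluster w a i (fun S => o ∈ S) hP le_rfl h' hup
  rw [setOf_mem_openCluster_eq, setOf_mem_openCluster_eq, ← biInter_openConn_eq_setOf, add_zero] at key
  -- `key : μ.real (Xa ∩ Q) ≤ μ.real (Xi ∩ Q)`; remove the common part `Xa ∩ Xi ∩ Q`
  have hmXa : MeasurableSet Xa := measurableSet_openConn' o a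
  have hmXi : MeasurableSet Xi := measurableSet_openConn' o i
  have h1 : μ.real (Xa ∩ Q ∩ Xi) + μ.real ((Xa ∩ Q) \ Xi) = μ.real (Xa ∩ Q) :=
    measureReal_inter_add_sdiff hmXi
  have h2 : μ.real (Xi ∩ Q ∩ Xa) + μ.real ((Xi ∩ Q) \ Xa) = μ.real (Xi ∩ Q) :=
    measureReal_inter_add_sdiff hmXa
  have hcomm : Xa ∩ Q ∩ Xi = Xi ∩ Q ∩ Xa := by
    ext ω; simp only [mem_inter_iff]; tauto
  have hdiff : μ.real ((Xa ∩ Q) \ Xi) ≤ μ.real ((Xi ∩ Q) \ Xa) := by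
    rw [hcomm] at h1; linarith
  -- the two sides of the claim sit inside / contain these differences
  have hL : Xa ∩ Xiᶜ ∩ Q ⊆ (Xa ∩ Q) \ Xi := by
    rintro ω ⟨⟨hωa, hωi⟩, hωQ⟩; exact ⟨⟨hωa, hωQ⟩, hωi⟩
  have hR : (Xi ∩ Q) \ Xa ⊆ Xaᶜ ∩ ⋂ j ∈ R, (openConn o j : Set (BondConfig V)) := by
    rintro ω ⟨⟨hωi, hωQ⟩, hωa⟩
    refine ⟨hωa, ?_⟩
    simp only [hQ, mem_iInter] at hωQ ⊢
    intro j hj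
    exact SimpleGraph.Reachable.trans hωi (hωQ j hj)
  calc μ.real (Xa ∩ Xiᶜ ∩ Q) ≤ μ.real ((Xa ∩ Q) \ Xi) := measureReal_mono hL
    _ ≤ μ.real ((Xi ∩ Q) \ Xa) := hdiff
    _ ≤ μ.real (Xaᶜ ∩ ⋂ j ∈ R, (openConn o j : Set (BondConfig V))) := measureReal_mono hR

end Summit.CriticalPhenomena.PercolationContinuityZ3.Theorems

end
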